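import Summits.HodgeConjecture.CorCM.IrreducibleOddWeightsCommutantDensityShadows
import HarnessLib

/-!
# Density over the commutant, VI: EQUALITY CASES — `𝔐(b) = A^J ⟺ b` D-free; ABSORPTION
# `S(w₁) ⊆ S(w₀) ⟺ D⟨b′⟩ ⊆ D⟨b⟩`; one component per side: `S(ι′ b′) ⊆ S(ι b) ⟺ b′ ∈ D·b`

COR-CM (cell `pub-hodgecm2`, binder seat `b16` gen 72, count-neutral claim DENSITY OVER THE COMMUTANT, file C6 —
abstract `G`-set level; theorems only, no definition, no named fact, no `sorry`).  NEW as stated, hence under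
`Summits/`.  HONEST FRAMING: a corollary of file C4's two counts `dim S(w₁)·δ = dim D⟨b′⟩·dim A` and
`dim(S(w₀) ∩ S(w₁))·δ = dim(D⟨b⟩ ∩ D⟨b′⟩)·dim A` (the meet attains `S(w₁)` iff the D-meet attains `D⟨b′⟩`); it
generalises gen 70's file I14 («a lone component is ABSORBED iff it is a RATIONAL combination of the partner's
components», scalar commutant) to an arbitrary commutant: absorbed iff a `D`-combination.  Linear algebra of
translates on finite `G`-sets; `HC_CM` is neither used nor asserted.

SETTING (file C4).  `A ≤ ℚ^{Y}` stable irreducible with commutant `𝒟` (a parameter with its characterising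
hypothesis), `w₀ = Σ_j ι_j(b_j)` on `Y₀`, `w₁ = Σ_k ι′_k(b′_k)` on `Y₁` for equivariant, jointly independent embeddings;
`S(w) = span{g ↦ w(g·y)}`, `D⟨b⟩ = ⨆_j D·b_j`.

* §1 (`V` arbitrary): **`𝔐(b) = A^J ⟺ b` is D-FREE** (`span_diag_orbit_eq_pi_iff_free`; the converse of file
  C3's density, `free_of_span_diag_orbit_eq_pi`, needs no hypothesis on `T` or `A`).
* §2 `span_shadowCoeff_le_iff_iSup_le` (`A ≠ 0`): **`S(w₁) ≤ S(w₀) ⟺ D⟨b′⟩ ≤ D⟨b⟩`**; hence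
  `span_shadowCoeff_eq_iff_iSup_eq`: **`S(w₁) = S(w₀) ⟺ D⟨b′⟩ = D⟨b⟩`**.
* one component per side (`span_shadowCoeff_le_iff_mem_single`): **`S(ι′ b′) ≤ S(ι b) ⟺ b′ ∈ D·b`**, and
  `S(ι′ b′) = S(ι b) ⟺ D·b′ = D·b` (for `b, b′ ≠ 0`: iff `b′ ∈ D·b`, D-lines being equal or disjoint).
In the lane's reading (gen 68/69: the defect is `dim(S(w₀) ∩ S(w₁))`), `S(w₁) ≤ S(w₀)` says that along this class
the shadow `w₁` contributes NOTHING NEW to `Hg(A₀ × A₁)` beyond `Hg(A₀)`: the defect takes its maximal value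
`dim S(w₁)`.

## References

* [Lang2002] S. Lang, *Algebra*, 3rd ed., XVII §1, XVII §3.
* [Serre1977] J.-P. Serre, *Linear Representations of Finite Groups*, GTM 42, §2.6.
* [Gordon1999HodgeAVSurvey] B. B. Gordon, *A survey of the Hodge conjecture for abelian varieties*, §3, 7.5–7.7.
-/

set_option autoImplicit false

noncomputable section

open scoped BigOperators Classical

universe u u' v v' v'' w

namespace Summit.HodgeConjecture.CorCM.IrrOdd

/-! ### §1 The equality case of density: `𝔐(b) = A^J ⟺ b` is D-free -/

section Free

variable {V : Type v} [AddCommGroup V] [Module ℚ V] {ι : Type w} (T : ι → V →ₗ[ℚ] V)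

/-- **THE CONVERSE OF DENSITY: `𝔐(b) = A^J ⟹ b` is D-FREE** (any family `T`, any `A`, commutant `𝒟`): a relation
`Σ_j L_j b_j = 0` gives the map `(f_j) ↦ Σ_j L_j f_j` vanishing on `𝔐(b)` (its elements are `(φ b_j)` with `φ ∈ span(T)`
commuting with the `L_j` on `A`), hence on every `single_j(a)`, `a ∈ A`. [cite: Lang2002, XVII §3] -/
theorem free_of_span_diag_orbit_eq_pi {𝒟 : Submodule ℚ (V →ₗ[ℚ] V)} {A : Submodule ℚ V}
    (h𝒟 : ∀ L : V →ₗ[ℚ] V, L ∈ 𝒟 ↔ (∀ a ∈ A, L a ∈ A) ∧ ∀ (i : ι) (a : V), a ∈ A → L (T i a) = T i (L a))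
    {J : Type u} [Fintype J] {b : J → V} (hb : ∀ j, b j ∈ A)
    (hM : Submodule.span ℚ (Set.range fun i : ι => fun j : J => T i (b j)) = Submodule.pi Set.univ (fun _ : J => A)) :
    ∀ L : J → (V →ₗ[ℚ] V), (∀ j, L j ∈ 𝒟) → ∑ j, L j (b j) = 0 → ∀ (j : J) (a : V), a ∈ A → L j a = 0 := by
  intro L hL hsum j₀ a ha
  have key : ∀ f ∈ Submodule.span ℚ (Set.range fun i : ι => fun j : J => T i (b j)), ∑ j, L j (f j) = 0 := by
    intro f hf
    obtain ⟨φ, hφ, rfl⟩ := exists_mem_span_range_of_mem_span_diag_orbit T b hf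
    calc ∑ j, L j (φ (b j)) = ∑ j, φ (L j (b j)) :=
          Finset.sum_congr rfl fun j _ => commutant_apply_comm_of_mem_span_range T h𝒟 (hL j) hφ (hb j)
      _ = 0 := by rw [← map_sum, hsum, map_zero]
  have hmem : (Pi.single j₀ a : J → V) ∈ Submodule.span ℚ (Set.range fun i : ι => fun j : J => T i (b j)) := by
    rw [hM]
    intro j _
    by_cases h : j = j₀
    · subst h
      rw [Pi.single_eq_same]
      exact ha
    · rw [Pi.single_eq_of_ne h]
      exact Submodule.zero_mem _
  have h := key _ hmem
  rw [Finset.sum_eq_single j₀ (fun j _ hj => by rw [Pi.single_eq_of_ne hj, map_zero])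
    (fun h' => absurd (Finset.mem_univ j₀) h'), Pi.single_eq_same] at h
  exact h

/-- **`𝔐(b) = A^J ⟺ b` IS D-FREE** (`T` closed under composition with identity, `A` finite-dimensional stable
irreducible, ANY commutant): density (file C3) and its converse. [cite: Lang2002, XVII §3]
[cite: CurtisReiner1962, §27 (27.8)] -/
theorem span_diag_orbit_eq_pi_iff_free {𝒟 : Submodule ℚ (V →ₗ[ℚ] V)} {A : Submodule ℚ V} [FiniteDimensional ℚ A]
    (h𝒟 : ∀ L : V →ₗ[ℚ] V, L ∈ 𝒟 ↔ (∀ a ∈ A, L a ∈ A) ∧ ∀ (i : ι) (a : V), a ∈ A → L (T i a) = T i (L a))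
    (h1 : ∃ i₀ : ι, T i₀ = LinearMap.id) (hmul : ∀ i i' : ι, ∃ i'' : ι, T i'' = T i ∘ₗ T i')
    (hAst : ∀ (i : ι) (v : V), v ∈ A → T i v ∈ A)
    (hAirr : ∀ W : Submodule ℚ V, W ≤ A → W ≠ ⊥ → (∀ (i : ι) (v : V), v ∈ W → T i v ∈ W) → W = A)
    {J : Type u} [Fintype J] {b : J → V} (hb : ∀ j, b j ∈ A) :
    Submodule.span ℚ (Set.range fun i : ι => fun j : J => T i (b j)) = Submodule.pi Set.univ (fun _ : J => A) ↔
      ∀ L : J → (V →ₗ[ℚ] V), (∀ j, L j ∈ 𝒟) → ∑ j, L j (b j) = 0 → ∀ (j : J) (a : V), a ∈ A → L j a = 0 :=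
  ⟨free_of_span_diag_orbit_eq_pi T h𝒟 hb, span_diag_orbit_eq_pi_of_free T h𝒟 h1 hmul hAst hAirr hb⟩

end Free

/-! ### §2 Absorption -/

variable {G : Type w} [Group G] {Y : Type v} [MulAction G Y] [Fintype Y]
  {Y₀ : Type v'} [MulAction G Y₀] [Fintype Y₀] {Y₁ : Type v''} [MulAction G Y₁] [Fintype Y₁]

/-- **ABSORPTION OVER THE COMMUTANT: `S(w₁) ≤ S(w₀) ⟺ D⟨b′⟩ ≤ D⟨b⟩`** (`A ≠ 0` stable irreducible with ANY
commutant; `w₀ = Σ_j ι_j(b_j)`, `w₁ = Σ_k ι′_k(b′_k)` for equivariant, jointly independent embeddings of `A`).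
[cite: Lang2002, XVII §3] [cite: Serre1977, §2.6] [cite: Gordon1999HodgeAVSurvey, §3 Theorem (proof), 7.5–7.7] -/
theorem span_shadowCoeff_le_iff_iSup_le {A : Submodule ℚ (Y → ℚ)} {𝒟 : Submodule ℚ ((Y → ℚ) →ₗ[ℚ] (Y → ℚ))}
    (h𝒟 : ∀ L : (Y → ℚ) →ₗ[ℚ] (Y → ℚ), L ∈ 𝒟 ↔ (∀ a ∈ A, L a ∈ A) ∧
      ∀ (k : G) (a : Y → ℚ), a ∈ A → L (fun y => a (k • y)) = fun y => L a (k • y))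
    (hAst : ∀ (k : G) (a : Y → ℚ), a ∈ A → (fun y => a (k • y)) ∈ A)
    (hAirr : ∀ W : Submodule ℚ (Y → ℚ), W ≤ A → W ≠ ⊥ →
      (∀ (k : G) (f : Y → ℚ), f ∈ W → (fun y => f (k • y)) ∈ W) → W = A)
    (hA0 : A ≠ ⊥) {J₀ : Type u} {J₁ : Type u'} [Fintype J₀] [Fintype J₁]
    (ι₀ : J₀ → ((Y → ℚ) →ₗ[ℚ] (Y₀ → ℚ))) (ι₁ : J₁ → ((Y → ℚ) →ₗ[ℚ] (Y₁ → ℚ)))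
    (hι₀eq : ∀ (j : J₀) (k : G) (a : Y → ℚ), a ∈ A → ι₀ j (fun y => a (k • y)) = fun y => ι₀ j a (k • y))
    (hι₁eq : ∀ (j : J₁) (k : G) (a : Y → ℚ), a ∈ A → ι₁ j (fun y => a (k • y)) = fun y => ι₁ j a (k • y))
    (hind₀ : ∀ f : J₀ → (Y → ℚ), (∀ j, f j ∈ A) → ∑ j, ι₀ j (f j) = 0 → ∀ j, f j = 0)
    (hind₁ : ∀ f : J₁ → (Y → ℚ), (∀ j, f j ∈ A) → ∑ j, ι₁ j (f j) = 0 → ∀ j, f j = 0)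
    {b₀ : J₀ → (Y → ℚ)} {b₁ : J₁ → (Y → ℚ)} (hb₀ : ∀ j, b₀ j ∈ A) (hb₁ : ∀ j, b₁ j ∈ A) :
    Submodule.span ℚ (Set.range fun y : Y₁ => fun g : G => (∑ j, ι₁ j (b₁ j)) (g • y)) ≤
        Submodule.span ℚ (Set.range fun y : Y₀ => fun g : G => (∑ j, ι₀ j (b₀ j)) (g • y)) ↔
      (⨆ j, 𝒟.map (LinearMap.applyₗ (b₁ j))) ≤ ⨆ j, 𝒟.map (LinearMap.applyₗ (b₀ j)) := by
  obtain ⟨a₀, ha₀, h0⟩ := Submodule.exists_mem_ne_zero_of_ne_bot hA0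
  have hmeet := finrank_span_shadowCoeff_inf_mul_eq h𝒟 hAst hAirr ι₀ ι₁ hι₀eq hι₁eq hind₀ hind₁ hb₀ hb₁ ha₀ h0
  have hone := finrank_span_shadowCoeff_sum_mul_eq h𝒟 hAst hAirr ι₁ hι₁eq hind₁ hb₁ ha₀ h0
  let T : G → (Y → ℚ) →ₗ[ℚ] (Y → ℚ) := fun k => LinearMap.funLeft ℚ ℚ (fun y : Y => k • y)
  haveI : FiniteDimensional ℚ A := Submodule.finiteDimensional_of_le le_top
  have hA : 0 < Module.finrank ℚ A :=
    Nat.pos_of_ne_zero fun h' => hA0 (Submodule.finrank_eq_zero.1 h')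
  haveI : FiniteDimensional ℚ ↥(𝒟.map (LinearMap.applyₗ a₀)) :=
    Submodule.finiteDimensional_of_le (map_applyₗ_le T (A := A) (fun L => h𝒟 L) ha₀)
  have hδ : 0 < Module.finrank ℚ ↥(𝒟.map (LinearMap.applyₗ a₀)) :=
    Nat.pos_of_ne_zero fun h' => map_applyₗ_ne_bot T (A := A) (fun L => h𝒟 L) h0 (Submodule.finrank_eq_zero.1 h')
  haveI : FiniteDimensional ℚ ↥(Submodule.span ℚ (Set.range fun y : Y₁ => fun g : G =>
      (∑ j, ι₁ j (b₁ j)) (g • y))) := FiniteDimensional.span_of_finite ℚ (Set.finite_range _)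
  haveI : FiniteDimensional ℚ ↥(⨆ j, 𝒟.map (LinearMap.applyₗ (b₁ j))) :=
    Submodule.finiteDimensional_of_le (iSup_map_applyₗ_le T (A := A) (fun L => h𝒟 L) hb₁)
  constructor
  · intro hle
    rw [inf_eq_right.2 hle, hone] at hmeet
    exact inf_eq_right.1 (Submodule.eq_of_le_of_finrank_eq inf_le_right
      (Nat.eq_of_mul_eq_mul_right hA hmeet.symm))
  · intro hle
    rw [inf_eq_right.2 hle, ← hone] at hmeet
    exact inf_eq_right.1 (Submodule.eq_of_le_of_finrank_eq inf_le_right (Nat.eq_of_mul_eq_mul_right hδ hmeet))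

/-- **`S(w₁) = S(w₀) ⟺ D⟨b′⟩ = D⟨b⟩`** (same hypotheses). [cite: Lang2002, XVII §3] [cite: Serre1977, §2.6] -/
theorem span_shadowCoeff_eq_iff_iSup_eq {A : Submodule ℚ (Y → ℚ)} {𝒟 : Submodule ℚ ((Y → ℚ) →ₗ[ℚ] (Y → ℚ))}
    (h𝒟 : ∀ L : (Y → ℚ) →ₗ[ℚ] (Y → ℚ), L ∈ 𝒟 ↔ (∀ a ∈ A, L a ∈ A) ∧
      ∀ (k : G) (a : Y → ℚ), a ∈ A → L (fun y => a (k • y)) = fun y => L a (k • y))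
    (hAst : ∀ (k : G) (a : Y → ℚ), a ∈ A → (fun y => a (k • y)) ∈ A)
    (hAirr : ∀ W : Submodule ℚ (Y → ℚ), W ≤ A → W ≠ ⊥ →
      (∀ (k : G) (f : Y → ℚ), f ∈ W → (fun y => f (k • y)) ∈ W) → W = A)
    (hA0 : A ≠ ⊥) {J₀ : Type u} {J₁ : Type u'} [Fintype J₀] [Fintype J₁]
    (ι₀ : J₀ → ((Y → ℚ) →ₗ[ℚ] (Y₀ → ℚ))) (ι₁ : J₁ → ((Y → ℚ) →ₗ[ℚ] (Y₁ → ℚ)))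
    (hι₀eq : ∀ (j : J₀) (k : G) (a : Y → ℚ), a ∈ A → ι₀ j (fun y => a (k • y)) = fun y => ι₀ j a (k • y))
    (hι₁eq : ∀ (j : J₁) (k : G) (a : Y → ℚ), a ∈ A → ι₁ j (fun y => a (k • y)) = fun y => ι₁ j a (k • y))
    (hind₀ : ∀ f : J₀ → (Y → ℚ), (∀ j, f j ∈ A) → ∑ j, ι₀ j (f j) = 0 → ∀ j, f j = 0)
    (hind₁ : ∀ f : J₁ → (Y → ℚ), (∀ j, f j ∈ A) → ∑ j, ι₁ j (f j) = 0 → ∀ j, f j = 0)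
    {b₀ : J₀ → (Y → ℚ)} {b₁ : J₁ → (Y → ℚ)} (hb₀ : ∀ j, b₀ j ∈ A) (hb₁ : ∀ j, b₁ j ∈ A) :
    Submodule.span ℚ (Set.range fun y : Y₁ => fun g : G => (∑ j, ι₁ j (b₁ j)) (g • y)) =
        Submodule.span ℚ (Set.range fun y : Y₀ => fun g : G => (∑ j, ι₀ j (b₀ j)) (g • y)) ↔
      (⨆ j, 𝒟.map (LinearMap.applyₗ (b₁ j))) = ⨆ j, 𝒟.map (LinearMap.applyₗ (b₀ j)) := by
  rw [le_antisymm_iff, le_antisymm_iff,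
    span_shadowCoeff_le_iff_iSup_le h𝒟 hAst hAirr hA0 ι₀ ι₁ hι₀eq hι₁eq hind₀ hind₁ hb₀ hb₁,
    span_shadowCoeff_le_iff_iSup_le h𝒟 hAst hAirr hA0 ι₁ ι₀ hι₁eq hι₀eq hind₁ hind₀ hb₁ hb₀]

/-- **ONE COMPONENT PER SIDE: `S(ι′ b′) ≤ S(ι b) ⟺ b′ ∈ D·b`** (`A ≠ 0`; single equivariant embeddings injective on
`A`; `b, b′ ∈ A`) — `w₁ = ι′(b′)` is ABSORBED by `w₀ = ι(b)` iff `b′` lies on the D-LINE of `b`; for a scalar commutant: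
iff `b′ ∈ ℚb` (gen 70, file I14). [cite: Lang2002, XVII §3] [cite: CurtisReiner1962, §27 (27.3)]
[cite: Gordon1999HodgeAVSurvey, §3 Theorem (proof), 7.5–7.7] -/
theorem span_shadowCoeff_le_iff_mem_single {A : Submodule ℚ (Y → ℚ)} {𝒟 : Submodule ℚ ((Y → ℚ) →ₗ[ℚ] (Y → ℚ))}
    (h𝒟 : ∀ L : (Y → ℚ) →ₗ[ℚ] (Y → ℚ), L ∈ 𝒟 ↔ (∀ a ∈ A, L a ∈ A) ∧
      ∀ (k : G) (a : Y → ℚ), a ∈ A → L (fun y => a (k • y)) = fun y => L a (k • y))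
    (hAst : ∀ (k : G) (a : Y → ℚ), a ∈ A → (fun y => a (k • y)) ∈ A)
    (hAirr : ∀ W : Submodule ℚ (Y → ℚ), W ≤ A → W ≠ ⊥ →
      (∀ (k : G) (f : Y → ℚ), f ∈ W → (fun y => f (k • y)) ∈ W) → W = A)
    (hA0 : A ≠ ⊥) (ι₀ : (Y → ℚ) →ₗ[ℚ] (Y₀ → ℚ)) (ι₁ : (Y → ℚ) →ₗ[ℚ] (Y₁ → ℚ))
    (hι₀eq : ∀ (k : G) (a : Y → ℚ), a ∈ A → ι₀ (fun y => a (k • y)) = fun y => ι₀ a (k • y))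
    (hι₁eq : ∀ (k : G) (a : Y → ℚ), a ∈ A → ι₁ (fun y => a (k • y)) = fun y => ι₁ a (k • y))
    (hinj₀ : ∀ f ∈ A, ι₀ f = 0 → f = 0) (hinj₁ : ∀ f ∈ A, ι₁ f = 0 → f = 0)
    {b₀ b₁ : Y → ℚ} (hb₀ : b₀ ∈ A) (hb₁ : b₁ ∈ A) :
    Submodule.span ℚ (Set.range fun y : Y₁ => fun g : G => ι₁ b₁ (g • y)) ≤
        Submodule.span ℚ (Set.range fun y : Y₀ => fun g : G => ι₀ b₀ (g • y)) ↔
      b₁ ∈ 𝒟.map (LinearMap.applyₗ b₀) := by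
  let T : G → (Y → ℚ) →ₗ[ℚ] (Y → ℚ) := fun k => LinearMap.funLeft ℚ ℚ (fun y : Y => k • y)
  have h := span_shadowCoeff_le_iff_iSup_le h𝒟 hAst hAirr hA0 (J₀ := Unit) (J₁ := Unit) (fun _ => ι₀) (fun _ => ι₁)
    (fun _ k a ha => hι₀eq k a ha) (fun _ k a ha => hι₁eq k a ha)
    (fun f hf hf0 j => by
      cases j
      exact hinj₀ _ (hf _) (by rw [← hf0]; exact (Fintype.sum_unique fun j => ι₀ (f j)).symm))
    (fun f hf hf0 j => by
      cases j
      exact hinj₁ _ (hf _) (by rw [← hf0]; exact (Fintype.sum_unique fun j => ι₁ (f j)).symm))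
    (b₀ := fun _ => b₀) (b₁ := fun _ => b₁) (fun _ => hb₀) (fun _ => hb₁)
  rw [Fintype.sum_unique, Fintype.sum_unique, iSup_const, iSup_const] at h
  refine h.trans ⟨fun hle => hle (self_mem_map_applyₗ T (A := A) (fun L => h𝒟 L) b₁), fun hmem => ?_⟩
  exact map_applyₗ_le_of_mem (map_applyₗ_stable T (A := A) (fun L => h𝒟 L) b₀) hmem

/-- **`S(ι′ b′) = S(ι b) ⟺ D·b′ = D·b`**; for `b, b′ ≠ 0` this is again `b′ ∈ D·b` (D-lines are equal or disjoint,
file C1). [cite: Lang2002, XVII §3] [cite: CurtisReiner1962, §27 (27.3)] -/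
theorem span_shadowCoeff_eq_iff_map_applyₗ_eq_single {A : Submodule ℚ (Y → ℚ)}
    {𝒟 : Submodule ℚ ((Y → ℚ) →ₗ[ℚ] (Y → ℚ))}
    (h𝒟 : ∀ L : (Y → ℚ) →ₗ[ℚ] (Y → ℚ), L ∈ 𝒟 ↔ (∀ a ∈ A, L a ∈ A) ∧
      ∀ (k : G) (a : Y → ℚ), a ∈ A → L (fun y => a (k • y)) = fun y => L a (k • y))
    (hAst : ∀ (k : G) (a : Y → ℚ), a ∈ A → (fun y => a (k • y)) ∈ A)
    (hAirr : ∀ W : Submodule ℚ (Y → ℚ), W ≤ A → W ≠ ⊥ →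
      (∀ (k : G) (f : Y → ℚ), f ∈ W → (fun y => f (k • y)) ∈ W) → W = A)
    (hA0 : A ≠ ⊥) (ι₀ : (Y → ℚ) →ₗ[ℚ] (Y₀ → ℚ)) (ι₁ : (Y → ℚ) →ₗ[ℚ] (Y₁ → ℚ))
    (hι₀eq : ∀ (k : G) (a : Y → ℚ), a ∈ A → ι₀ (fun y => a (k • y)) = fun y => ι₀ a (k • y))
    (hι₁eq : ∀ (k : G) (a : Y → ℚ), a ∈ A → ι₁ (fun y => a (k • y)) = fun y => ι₁ a (k • y))
    (hinj₀ : ∀ f ∈ A, ι₀ f = 0 → f = 0) (hinj₁ : ∀ f ∈ A, ι₁ f = 0 → f = 0)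
    {b₀ b₁ : Y → ℚ} (hb₀ : b₀ ∈ A) (hb₁ : b₁ ∈ A) :
    Submodule.span ℚ (Set.range fun y : Y₁ => fun g : G => ι₁ b₁ (g • y)) =
        Submodule.span ℚ (Set.range fun y : Y₀ => fun g : G => ι₀ b₀ (g • y)) ↔
      𝒟.map (LinearMap.applyₗ b₁) = 𝒟.map (LinearMap.applyₗ b₀) := by
  let T : G → (Y → ℚ) →ₗ[ℚ] (Y → ℚ) := fun k => LinearMap.funLeft ℚ ℚ (fun y : Y => k • y)
  have hst := map_applyₗ_stable T (A := A) (fun L => h𝒟 L)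
  rw [le_antisymm_iff, le_antisymm_iff,
    span_shadowCoeff_le_iff_mem_single h𝒟 hAst hAirr hA0 ι₀ ι₁ hι₀eq hι₁eq hinj₀ hinj₁ hb₀ hb₁,
    span_shadowCoeff_le_iff_mem_single h𝒟 hAst hAirr hA0 ι₁ ι₀ hι₁eq hι₀eq hinj₁ hinj₀ hb₁ hb₀]
  constructor
  · rintro ⟨h10, h01⟩
    exact ⟨map_applyₗ_le_of_mem (hst b₀) h10, map_applyₗ_le_of_mem (hst b₁) h01⟩
  · rintro ⟨h10, h01⟩
    exact ⟨h10 (self_mem_map_applyₗ T (A := A) (fun L => h𝒟 L) b₁),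
      h01 (self_mem_map_applyₗ T (A := A) (fun L => h𝒟 L) b₀)⟩

end Summit.HodgeConjecture.CorCM.IrrOdd

end
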